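/-
Copyright (c) 2026 the pub-hodgecm-mathlib formalisation cell (harness21).  Prover seat hodgecm-mathlib-K2E4-p18 (g2), Track B «K2-LIT» ∕ h413
(stmt-HodgeConjecture-24833), deal K2E4-plan (g0) 22:15:18Z ∕ 22:31:39Z: socket #22S `sig_K2E4WeakMatrixFiniteTransportSplit` — SECOND RUNG: the split-place
bookkeeping discharged (one matching class, non-vanishing), leaving exactly (GS_v) + (LIFT_v).  2026-09-03.
-/
import Summits.HodgeConjecture.HodgeConjecture.Theorems.K2E4WeakMatrixFiniteTransportOfGermRigidity   -- ★ p855314 (this seat): Möbius rigidity, first rung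
import Literature.NumberTheory.Rogawski1990.LocalTransferSplitPlaceClasses          -- ★ one matching class at a split place
import Literature.NumberTheory.Rogawski1990.FinExplicitTransferFactorNondegenerate  -- ★ `isLocalNondegenerate_finExplicitCollection`
import HarnessLib

/-!
# K2 · E4 helper — socket #22S `sig_K2E4WeakMatrixFiniteTransportSplit` at a split place from (GS_v) + (LIFT_v) alone

Cell `pub/hodgecm-mathlib`, Track B «K2-LIT», seat `hodgecm-mathlib-K2E4-p18` (g2); crux H413 = `stmt-HodgeConjecture-24833` (supports-only helper).  THEOREMS ONLY
(no definition, no instance, no notation, no named fact, no `sorry`).  Continues ★ `K2E4WeakMatrixFiniteTransportOfGermRigidity` (p855314, REPORT-22 §3), whose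
`weakMatrixFiniteTransport_of_germStructure` proves #22's per-place implication from four hypotheses (i) transfer existence for the weak and the explicit factor,
(ii) a ray of `G`-regular elements with ONE matching class for both factors and both factors non-zero there, (iii) the germ structure (GS_v), (iv) two explicit
pairs with independent germ coefficients (RK2_v).  THIS FILE discharges (ii) at a place `v` of `L⁺` SPLIT in `L` from the tree (★ `LocalTransferSplitPlaceClasses`:
every `γ_H` has a match `exists_isLocalNormPair_of_split`, two matches are conjugate `isConj_of_isLocalNormPair_of_split`; non-vanishing from ★ `IsLocalNondegenerate`
of the weak factor (`hCTM`) and ★ `isLocalNondegenerate_finExplicitCollection`), and reduces (iv) to (GS_v)'s rank-two clause plus the GERM LIFT (LIFT_v) «every smooth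
`φ` on `H_v` has an explicit transfer pair whose stable orbital integrals agree with those of `φ` at the `G`-regular points of a neighbourhood of `z_v`» (equal
orbital integrals along the tail of the ray ⇒ equal germ pair).  Result: **`weakMatrixFiniteTransportSplit_of_germStructure`** = #22S at `v` modulo exactly the two
cand sockets (GS_v) `sig_K2E3CentralGermStructureSplit` (E3, H-side, Δ-free) and (LIFT_v) `sig_K2E4SplitTransferGermLift` (E4) of
`K2/K2E4-p18/g2/sig_K2E4Socket22Inputs.cand.K2E4-p18-g2.lean`, whose conclusions appear here as the hypotheses `hGS`, `hGS2`, `hγz`, `hLIFT` TOKEN FOR TOKEN, plus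
`Δ‴_v`-transfer existence (★ `isLocalDeltaTransfer_cmSplitTransfer` at split `v`).
HONEST LABEL: HC_CM is proved only modulo the 7 printed citations (2 remaining named inputs: hLiu418 = stmt-HodgeConjecture-24832, h413 = stmt-HodgeConjecture-24833)
until rung 0 closes; this file proves no printed analytic statement and does NOT pay #22S (it pays it modulo (GS_v) + (LIFT_v)).

## References
* [Rogawski1990] J. D. Rogawski, *Automorphic Representations of Unitary Groups in Three Variables* (1990): §4.13 Lemma 4.13.1 (a) p. 64 (split places: `G′_v ≅ GL₃`,
  one class); §14.2 p. 232 («for `v` split stable conjugacy coincides with conjugacy»); §8.1 (8.1.1)–(8.1.2) p. 117; §8.2 Prop. 8.2.1 (a) p. 117.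
* [HarishChandra1999AdmissibleDistributions] Harish-Chandra, *Admissible invariant distributions on reductive p-adic groups* (1999), Thm. 3.1.
-/

set_option autoImplicit false
set_option linter.dupNamespace false

noncomputable section

open MeasureTheory Measure NumberField IsDedekindDomain Filter
open Literature.NumberTheory.Rogawski1990 Literature.NumberTheory.Automorphic Literature.NumberTheory.GaloisRepresentations
open Literature.NumberTheory.Automorphic.UnitaryGroup (placeForm)
open Summit.HodgeConjecture.HodgeConjecture.Cruxes.H413.K2E4WeakMatrixFiniteTransportOfGermRigidity (weakMatrixFiniteTransport_of_germStructure)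
open scoped Matrix MatrixGroups

namespace Summit.HodgeConjecture.HodgeConjecture.Cruxes.H413.K2E4WeakMatrixFiniteTransportSplitOfGermStructure

variable (L : Type) [Field L] [NumberField L] [IsCMField L] (H' : Matrix (Fin 3) (Fin 3) L) (v : HeightOneSpectrum (𝓞 ↥(maximalRealSubfield L)))

/-- **ONE MATCHING CLASS ALONG A RAY AT A SPLIT PLACE, for ANY local transfer factor**: if `γ_H → γ_G`, then `Δ_T(γ_H, c) = 0` at every class `c ≠ [γ_G]`
(★ `eq_zero_of_not_rel` + ★ `isConj_of_isLocalNormPair_of_split`). [cite: Rogawski1990, §14.2 p. 232; §4.13 Lemma 4.13.1 (a) p. 64] -/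
theorem delta_eq_zero_of_ne_mk_of_split (hH' : (H'.map (IsCMField.complexConj L))ᵀ = H') (w : UnitaryGroup.PlacesOver L v)
    (hw : IsCMField.complexConj L • w.1 ≠ w.1) (hH'w : IsUnit (placeForm H' w.1)) (T : LocalTransferFactor L H' v)
    {γH : ((UnitaryGroup.cmDatum L 2 (Matrix.of fun i j : Fin 2 => if i.val + j.val + 1 = 2 then (1 : L) else 0)).Local v ×
        (UnitaryGroup.cmDatum L 1 (Matrix.of fun i j : Fin 1 => if i.val + j.val + 1 = 1 then (1 : L) else 0)).Local v)}
    {γG : (UnitaryGroup.cmDatum L 3 H').Local v} (hγG : IsLocalNormPair L H' v γH γG) (c : ConjClasses ((UnitaryGroup.cmDatum L 3 H').Local v)) (hc : c ≠ ConjClasses.mk γG) :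
    T.Δ γH (Quotient.out c) = 0 := by
  by_contra hne
  have hrel : IsLocalNormPair L H' v γH (Quotient.out c) := by
    by_contra hnr
    exact hne (T.eq_zero_of_not_rel _ _ hnr)
  have hconj : IsConj γG (Quotient.out c) := isConj_of_isLocalNormPair_of_split L H' hH' w hw hH'w hγG hrel
  exact hc ((Quotient.out_eq c).symm.trans (ConjClasses.mk_eq_mk_iff_isConj.2 hconj.symm))

/-- `out [γ_G]` matches `γ_H` when `γ_G` does (matching is a class function, ★ `isLocalNormPair_conj_right`). [cite: Rogawski1990, §4.3 p. 43] -/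
theorem isLocalNormPair_out_mk
    {γH : ((UnitaryGroup.cmDatum L 2 (Matrix.of fun i j : Fin 2 => if i.val + j.val + 1 = 2 then (1 : L) else 0)).Local v ×
        (UnitaryGroup.cmDatum L 1 (Matrix.of fun i j : Fin 1 => if i.val + j.val + 1 = 1 then (1 : L) else 0)).Local v)}
    {γG : (UnitaryGroup.cmDatum L 3 H').Local v} (hγG : IsLocalNormPair L H' v γH γG) :
    IsLocalNormPair L H' v γH (Quotient.out (ConjClasses.mk γG)) := by
  obtain ⟨y, hy⟩ := isConj_iff.1 (ConjClasses.mk_eq_mk_iff_isConj.1 (Quotient.out_eq (ConjClasses.mk γG)).symm)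
  rw [← hy]
  exact (isLocalNormPair_conj_right L v H' γH γG y).2 hγG

/-- **SOCKET #22S AT A SPLIT PLACE, MODULO (GS_v) + (LIFT_v)** — `sig_K2E4WeakMatrixFiniteTransportSplit`'s per-place implication (functional
`localStableOrbitalIntegral L 3 H′ v mGs₀v f (γ₀)_v`, point `(γ_H)_v`, reference factor `finExplicitCollection L H′ μ … v`, families read at the fixed `v`) at a
place `v` SPLIT in `L` (`w ∣ v` with `c̄w ≠ w`), from: non-degeneracy and smooth-transfer existence for the weak `Δv` (`hCTM`'s `IsLocalTransferDatum`), smooth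
`Δ‴_v`-transfer existence (★ `isLocalDeltaTransfer_cmSplitTransfer`), the conclusion of (GS_v) `sig_K2E3CentralGermStructureSplit` (ray `γ`, `G`, `λ, λ′`, germ relation,
rank two — `hreg`, `hγz`, `hG`, `hGS`, `hGS2`) and the conclusion of (LIFT_v) `sig_K2E4SplitTransferGermLift` (`hLIFT`).  One matching class and the non-vanishing of
both factors along the ray are PROVED here; the rest is ★ `weakMatrixFiniteTransport_of_germStructure`.  The semiregularity binders of the socket are not read.
[cite: Rogawski1990, §8.2 Prop. 8.2.1 (a) p. 117; §4.13 Lemma 4.13.1 (a) p. 64] [cite: HarishChandra1999AdmissibleDistributions, Thm. 3.1] -/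
theorem weakMatrixFiniteTransportSplit_of_germStructure
    {_ha : ∀ a : ((UnitaryGroup.cmDatum L 2 (Matrix.of fun i j : Fin 2 => if i.val + j.val + 1 = 2 then (1 : L) else 0)).Local v ×
        (UnitaryGroup.cmDatum L 1 (Matrix.of fun i j : Fin 1 => if i.val + j.val + 1 = 1 then (1 : L) else 0)).Local v),
      MeasurableSpace (((UnitaryGroup.cmDatum L 2 (Matrix.of fun i j : Fin 2 => if i.val + j.val + 1 = 2 then (1 : L) else 0)).Local v × (UnitaryGroup.cmDatum L 1 (Matrix.of fun i j : Fin 1 => if i.val + j.val + 1 = 1 then (1 : L) else 0)).Local v) ⧸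
        Subgroup.centralizer ({a} : Set ((UnitaryGroup.cmDatum L 2 (Matrix.of fun i j : Fin 2 => if i.val + j.val + 1 = 2 then (1 : L) else 0)).Local v × (UnitaryGroup.cmDatum L 1 (Matrix.of fun i j : Fin 1 => if i.val + j.val + 1 = 1 then (1 : L) else 0)).Local v)))}
    {_hγ : ∀ γ : (UnitaryGroup.cmDatum L 3 H').Local v,
      MeasurableSpace ((UnitaryGroup.cmDatum L 3 H').Local v ⧸ Subgroup.centralizer ({γ} : Set ((UnitaryGroup.cmDatum L 3 H').Local v)))}
    (hc : IsCMField.complexConj L ≠ 1) (w : UnitaryGroup.PlacesOver L v) (hw : IsCMField.complexConj L • w.1 ≠ w.1)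
    (hΦ₂ : ((Matrix.of fun i j : Fin 2 => if i.val + j.val + 1 = 2 then (1 : L) else 0).map (IsCMField.complexConj L))ᵀ =
      (Matrix.of fun i j : Fin 2 => if i.val + j.val + 1 = 2 then (1 : L) else 0))
    (hΦ₂w : IsUnit (placeForm (Matrix.of fun i j : Fin 2 => if i.val + j.val + 1 = 2 then (1 : L) else 0) w.1))
    (hΦ₁ : ((Matrix.of fun i j : Fin 1 => if i.val + j.val + 1 = 1 then (1 : L) else 0).map (IsCMField.complexConj L))ᵀ =
      (Matrix.of fun i j : Fin 1 => if i.val + j.val + 1 = 1 then (1 : L) else 0))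
    (hΦ₁w : IsUnit (placeForm (Matrix.of fun i j : Fin 1 => if i.val + j.val + 1 = 1 then (1 : L) else 0) w.1))
    (hH' : (H'.map (IsCMField.complexConj L))ᵀ = H') (hH'w : IsUnit (placeForm H' w.1))
    (Δv : LocalTransferFactor L H' v) (μ : HeckeCharacter L)
    (mHv : OrbitalMeasureFamily ((UnitaryGroup.cmDatum L 2 (Matrix.of fun i j : Fin 2 => if i.val + j.val + 1 = 2 then (1 : L) else 0)).Local v ×
        (UnitaryGroup.cmDatum L 1 (Matrix.of fun i j : Fin 1 => if i.val + j.val + 1 = 1 then (1 : L) else 0)).Local v))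
    (mGv mGs₀v : OrbitalMeasureFamily ((UnitaryGroup.cmDatum L 3 H').Local v))
    (hnd : IsLocalNondegenerate L H' v Δv)
    (hT : IsLocalDeltaTransferExists L H' v Δv mHv mGv IsLocSmooth IsLocSmooth)
    (hTexp : IsLocalDeltaTransferExists L H' v (finExplicitCollection L H' μ (finExplicitDelta_conj_left_all L H' μ) (finExplicitDelta_conj_right_all L H' μ) v) mHv mGv IsLocSmooth IsLocSmooth)
    (γ₀ : (UnitaryGroup.cmDatum L 3 H').Rational)
    (γH : (UnitaryGroup.cmDatum L 2 (Matrix.of fun i j : Fin 2 => if i.val + j.val + 1 = 2 then (1 : L) else 0)).Rational ×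
      (UnitaryGroup.cmDatum L 1 (Matrix.of fun i j : Fin 1 => if i.val + j.val + 1 = 1 then (1 : L) else 0)).Rational)
    (γ : ℕ → ((UnitaryGroup.cmDatum L 2 (Matrix.of fun i j : Fin 2 => if i.val + j.val + 1 = 2 then (1 : L) else 0)).Local v ×
        (UnitaryGroup.cmDatum L 1 (Matrix.of fun i j : Fin 1 => if i.val + j.val + 1 = 1 then (1 : L) else 0)).Local v)) (hreg : ∀ n, IsLocalGRegular L v (γ n))
    (hγz : Tendsto γ atTop (nhds
      ((UnitaryGroup.cmDatum L 2 (Matrix.of fun i j : Fin 2 => if i.val + j.val + 1 = 2 then (1 : L) else 0)).toLocal v ((UnitaryGroup.cmDatum L 2 (Matrix.of fun i j : Fin 2 => if i.val + j.val + 1 = 2 then (1 : L) else 0)).toAdelic γH.1),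
            (UnitaryGroup.cmDatum L 1 (Matrix.of fun i j : Fin 1 => if i.val + j.val + 1 = 1 then (1 : L) else 0)).toLocal v ((UnitaryGroup.cmDatum L 1 (Matrix.of fun i j : Fin 1 => if i.val + j.val + 1 = 1 then (1 : L) else 0)).toAdelic γH.2))))
    (G : ℕ → ℂ) (hG : (Set.range G).Infinite) (lam lam' : ℂ)
    (hGS : ∀ φ : ((UnitaryGroup.cmDatum L 2 (Matrix.of fun i j : Fin 2 => if i.val + j.val + 1 = 2 then (1 : L) else 0)).Local v ×
        (UnitaryGroup.cmDatum L 1 (Matrix.of fun i j : Fin 1 => if i.val + j.val + 1 = 1 then (1 : L) else 0)).Local v) → ℂ, IsLocSmooth φ →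
      ∃ a b : ℂ, (∀ᶠ n in atTop, stableOrbitalIntegralRel (IsLocalStablyConjH L v) mHv φ (γ n) = a + b * G n) ∧
        φ ((UnitaryGroup.cmDatum L 2 (Matrix.of fun i j : Fin 2 => if i.val + j.val + 1 = 2 then (1 : L) else 0)).toLocal v ((UnitaryGroup.cmDatum L 2 (Matrix.of fun i j : Fin 2 => if i.val + j.val + 1 = 2 then (1 : L) else 0)).toAdelic γH.1),
            (UnitaryGroup.cmDatum L 1 (Matrix.of fun i j : Fin 1 => if i.val + j.val + 1 = 1 then (1 : L) else 0)).toLocal v ((UnitaryGroup.cmDatum L 1 (Matrix.of fun i j : Fin 1 => if i.val + j.val + 1 = 1 then (1 : L) else 0)).toAdelic γH.2)) = lam * a + lam' * b)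
    (hGS2 : ∃ (φ₁ φ₂ : ((UnitaryGroup.cmDatum L 2 (Matrix.of fun i j : Fin 2 => if i.val + j.val + 1 = 2 then (1 : L) else 0)).Local v ×
        (UnitaryGroup.cmDatum L 1 (Matrix.of fun i j : Fin 1 => if i.val + j.val + 1 = 1 then (1 : L) else 0)).Local v) → ℂ) (a₁ b₁ a₂ b₂ : ℂ), IsLocSmooth φ₁ ∧ IsLocSmooth φ₂ ∧
      (∀ᶠ n in atTop, stableOrbitalIntegralRel (IsLocalStablyConjH L v) mHv φ₁ (γ n) = a₁ + b₁ * G n) ∧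
      (∀ᶠ n in atTop, stableOrbitalIntegralRel (IsLocalStablyConjH L v) mHv φ₂ (γ n) = a₂ + b₂ * G n) ∧ a₁ * b₂ - a₂ * b₁ ≠ 0)
    (hLIFT : ∀ φ : ((UnitaryGroup.cmDatum L 2 (Matrix.of fun i j : Fin 2 => if i.val + j.val + 1 = 2 then (1 : L) else 0)).Local v ×
        (UnitaryGroup.cmDatum L 1 (Matrix.of fun i j : Fin 1 => if i.val + j.val + 1 = 1 then (1 : L) else 0)).Local v) → ℂ, IsLocSmooth φ →
      ∃ (f : (UnitaryGroup.cmDatum L 3 H').Local v → ℂ) (φ' : ((UnitaryGroup.cmDatum L 2 (Matrix.of fun i j : Fin 2 => if i.val + j.val + 1 = 2 then (1 : L) else 0)).Local v ×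
        (UnitaryGroup.cmDatum L 1 (Matrix.of fun i j : Fin 1 => if i.val + j.val + 1 = 1 then (1 : L) else 0)).Local v) → ℂ), IsLocSmooth f ∧ IsLocSmooth φ' ∧
        IsLocalDeltaTransfer L H' v (finExplicitCollection L H' μ (finExplicitDelta_conj_left_all L H' μ) (finExplicitDelta_conj_right_all L H' μ) v) mHv mGv φ' f ∧
        ∃ V ∈ nhds ((UnitaryGroup.cmDatum L 2 (Matrix.of fun i j : Fin 2 => if i.val + j.val + 1 = 2 then (1 : L) else 0)).toLocal v ((UnitaryGroup.cmDatum L 2 (Matrix.of fun i j : Fin 2 => if i.val + j.val + 1 = 2 then (1 : L) else 0)).toAdelic γH.1),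
            (UnitaryGroup.cmDatum L 1 (Matrix.of fun i j : Fin 1 => if i.val + j.val + 1 = 1 then (1 : L) else 0)).toLocal v ((UnitaryGroup.cmDatum L 1 (Matrix.of fun i j : Fin 1 => if i.val + j.val + 1 = 1 then (1 : L) else 0)).toAdelic γH.2)),
          ∀ γH' ∈ V, IsLocalGRegular L v γH' →
            stableOrbitalIntegralRel (IsLocalStablyConjH L v) mHv φ' γH' = stableOrbitalIntegralRel (IsLocalStablyConjH L v) mHv φ γH') :
    (∃ cv : ℂ, cv ≠ 0 ∧ ∀
          (fH : ((UnitaryGroup.cmDatum L 2 (Matrix.of fun i j : Fin 2 => if i.val + j.val + 1 = 2 then (1 : L) else 0)).Local v ×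
        (UnitaryGroup.cmDatum L 1 (Matrix.of fun i j : Fin 1 => if i.val + j.val + 1 = 1 then (1 : L) else 0)).Local v) → ℂ) (f : (UnitaryGroup.cmDatum L 3 H').Local v → ℂ),
        IsLocSmooth f → IsLocSmooth fH → IsLocalDeltaTransfer L H' v (finExplicitCollection L H' μ (finExplicitDelta_conj_left_all L H' μ) (finExplicitDelta_conj_right_all L H' μ) v) mHv mGv fH f →
        localStableOrbitalIntegral L 3 H' v mGs₀v f ((UnitaryGroup.cmDatum L 3 H').toLocal v ((UnitaryGroup.cmDatum L 3 H').toAdelic γ₀)) =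
          cv * fH ((UnitaryGroup.cmDatum L 2 (Matrix.of fun i j : Fin 2 => if i.val + j.val + 1 = 2 then (1 : L) else 0)).toLocal v ((UnitaryGroup.cmDatum L 2 (Matrix.of fun i j : Fin 2 => if i.val + j.val + 1 = 2 then (1 : L) else 0)).toAdelic γH.1),
            (UnitaryGroup.cmDatum L 1 (Matrix.of fun i j : Fin 1 => if i.val + j.val + 1 = 1 then (1 : L) else 0)).toLocal v ((UnitaryGroup.cmDatum L 1 (Matrix.of fun i j : Fin 1 => if i.val + j.val + 1 = 1 then (1 : L) else 0)).toAdelic γH.2))) →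
    ∃ cv : ℂ, cv ≠ 0 ∧ ∀
          (fH : ((UnitaryGroup.cmDatum L 2 (Matrix.of fun i j : Fin 2 => if i.val + j.val + 1 = 2 then (1 : L) else 0)).Local v ×
        (UnitaryGroup.cmDatum L 1 (Matrix.of fun i j : Fin 1 => if i.val + j.val + 1 = 1 then (1 : L) else 0)).Local v) → ℂ) (f : (UnitaryGroup.cmDatum L 3 H').Local v → ℂ),
        IsLocSmooth f → IsLocSmooth fH → IsLocalDeltaTransfer L H' v Δv mHv mGv fH f →
        localStableOrbitalIntegral L 3 H' v mGs₀v f ((UnitaryGroup.cmDatum L 3 H').toLocal v ((UnitaryGroup.cmDatum L 3 H').toAdelic γ₀)) =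
          cv * fH ((UnitaryGroup.cmDatum L 2 (Matrix.of fun i j : Fin 2 => if i.val + j.val + 1 = 2 then (1 : L) else 0)).toLocal v ((UnitaryGroup.cmDatum L 2 (Matrix.of fun i j : Fin 2 => if i.val + j.val + 1 = 2 then (1 : L) else 0)).toAdelic γH.1),
            (UnitaryGroup.cmDatum L 1 (Matrix.of fun i j : Fin 1 => if i.val + j.val + 1 = 1 then (1 : L) else 0)).toLocal v ((UnitaryGroup.cmDatum L 1 (Matrix.of fun i j : Fin 1 => if i.val + j.val + 1 = 1 then (1 : L) else 0)).toAdelic γH.2)) := by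
  intro hκ
  -- a matching element along the ray, and the class it defines
  have hmatch : ∀ n, ∃ g : (UnitaryGroup.cmDatum L 3 H').Local v, IsLocalNormPair L H' v (γ n) g := fun n => by
    obtain ⟨g, hg, -⟩ := exists_isLocalNormPair_of_split L H' hc w hw hΦ₂ hΦ₂w hΦ₁ hΦ₁w hH' hH'w (γ n)
    exact ⟨g, hg⟩
  choose γG hγG using hmatch
  -- rank two among explicit pairs: lift the two (GS_v) witnesses and read their germ pairs on the tail of the ray
  obtain ⟨φ₁, φ₂, a₁, b₁, a₂, b₂, hs₁, hs₂, hg₁, hg₂, hD⟩ := hGS2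
  obtain ⟨f₁, φ'₁, hf₁, hs'₁, ht₁, V₁, hV₁, hagree₁⟩ := hLIFT φ₁ hs₁
  obtain ⟨f₂, φ'₂, hf₂, hs'₂, ht₂, V₂, hV₂, hagree₂⟩ := hLIFT φ₂ hs₂
  have hg'₁ : ∀ᶠ n in atTop, stableOrbitalIntegralRel (IsLocalStablyConjH L v) mHv φ'₁ (γ n) = a₁ + b₁ * G n := by
    filter_upwards [hg₁, hγz.eventually_mem hV₁] with n hn hmem
    rw [hagree₁ (γ n) hmem (hreg n), hn]
  have hg'₂ : ∀ᶠ n in atTop, stableOrbitalIntegralRel (IsLocalStablyConjH L v) mHv φ'₂ (γ n) = a₂ + b₂ * G n := by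
    filter_upwards [hg₂, hγz.eventually_mem hV₂] with n hn hmem
    rw [hagree₂ (γ n) hmem (hreg n), hn]
  exact weakMatrixFiniteTransport_of_germStructure L H' v Δv μ mHv mGv mGs₀v hT hTexp γ₀ γH γ hreg (fun n => ConjClasses.mk (γG n))
    (fun n c hc' => delta_eq_zero_of_ne_mk_of_split L H' v hH' w hw hH'w Δv (hγG n) c hc')
    (fun n c hc' => delta_eq_zero_of_ne_mk_of_split L H' v hH' w hw hH'w _ (hγG n) c hc')
    (fun n => hnd _ _ (isLocalNormPair_out_mk L H' v (hγG n)) (hreg n))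
    (fun n => isLocalNondegenerate_finExplicitCollection L H' μ (finExplicitDelta_conj_left_all L H' μ)
      (finExplicitDelta_conj_right_all L H' μ) v _ _ (isLocalNormPair_out_mk L H' v (hγG n)) (hreg n))
    G hG lam lam' hGS ⟨f₁, f₂, φ'₁, φ'₂, a₁, b₁, a₂, b₂, hf₁, hf₂, hs'₁, hs'₂, ht₁, ht₂, hg'₁, hg'₂, hD⟩ hκ

end Summit.HodgeConjecture.HodgeConjecture.Cruxes.H413.K2E4WeakMatrixFiniteTransportSplitOfGermStructure

end
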